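import Literature.NumberTheory.EllipticCurves.HasseWeilGoodReductionFrobeniusProofs
import Literature.NumberTheory.EllipticCurves.FrobeniusTateModuleTraceProofs
import HarnessLib

/-!
# Euler factors of `V_ℓ E` at the places of good reduction: discharge of
# `WeierstrassCurve.hasseWeilEulerFactor_of_hasGoodReduction`

Topic `NumberTheory/EllipticCurves` (trunk T-ELLARITH). The `…Proofs` sibling (D-0014 append
protocol: nothing is defined, all declarations are theorems) of
`Literature.NumberTheory.EllipticCurves.HasseWeilGoodReduction` and
`Literature.NumberTheory.EllipticCurves.HasseWeilGoodReductionFrobenius`, discharging their three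
named facts now that every input is a theorem of the tree:

* `WeierstrassCurve.trace_galoisRepTate_frobenius_of_hasGoodReductionAt_holds` — Silverman,
  *AEC*, C.21 Remark 21.3 (the trace): `Trace ρ(φ_v) = a_v` on `T_ℓ E` for an arithmetic
  Frobenius `φ_v` at a place `v ∤ ℓ` of good reduction of an elliptic curve over a number field;
* `WeierstrassCurve.det_galoisRepTate_frobenius_of_hasGoodReductionAt_holds` — loc. cit. (the
  norm): `Norm ρ(φ_v) = q_v`;
* `WeierstrassCurve.hasseWeilEulerFactor_of_hasGoodReduction_holds` — C.§16 with C.21.3 and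
  Prop. VII.4.1: at a place `v ∤ ℓ` of good reduction the Euler factor `det(1 - Frob_v T | V_ℓ E)`
  (inertia coinvariants, geometric Frobenius; `hasseWeilEulerFactor` of `HasseWeilAbelian`) is
  `1 - a_v T + q_v T²`, Mathlib's `localPolynomial` of the reduction of a minimal model at `v`.

The inputs, all proved in the tree: good reduction is unramified and the Frobenius-equivariant
reduction isomorphism `T_ℓ E ≅ T_ℓ Ẽ_v` (Prop. VII.4.1, VII.2.1, VII.3.1(b);
`GoodReductionUnramifiedProofs`, `HasseWeilGoodReductionFrobeniusProofs`), `det ρ_{E,ℓ} = χ_ℓ`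
from the Weil pairing (Prop. III.8.1, III.8.3; `WeilPairingProofs`, `TateModuleDeterminantProofs`),
and Thm. V.2.3.1 for the reductions `Ẽ_v / k_v` (`trace_galoisRepTate_frobenius_holds`,
`FrobeniusTateModuleTraceProofs`; independently through Cor. III.6.3 and Prop. III.8.6,
`IsogenyDegreeQuadraticFormProofs`). A new leaf file rather than a Part 2 of
`HasseWeilGoodReductionFrobeniusProofs`: importing `FrobeniusTateModuleTraceProofs` there slows an
unrelated `isDefEq` in that file past the heartbeat limit.

## References

* [SilvermanAEC2009] J. H. Silverman, *The Arithmetic of Elliptic Curves*, 2nd ed., GTM 106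
  (2009): Prop. III.8.1, Thm. V.2.3.1 (PDF p. 129), Prop. VII.4.1 (PDF p. 173), C.§16 (PDF p. 390),
  C.21 Remark 21.3 (PDF p. 399).
-/

noncomputable section

namespace WeierstrassCurve

open IsDedekindDomain

universe u

variable {K : Type u} [Field K] [NumberField K] (W : WeierstrassCurve K) (ℓ : ℕ) [Fact ℓ.Prime]

/-- **Discharge of the named fact `trace_galoisRepTate_frobenius_of_hasGoodReductionAt W ℓ`**
(Silverman, *AEC*, C.21 Remark 21.3, the trace: `Trace ρ(φ_v) = a_v` for an arithmetic Frobenius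
`φ_v` at a place `v ∤ ℓ` of good reduction):
`trace_galoisRepTate_frobenius_of_hasGoodReductionAt_of_finiteField` (the reduction isomorphism
`T_ℓ E ≅ T_ℓ Ẽ_v`, `HasseWeilGoodReductionFrobeniusProofs`) with Thm. V.2.3.1 for the reductions
`Ẽ_v / k_v` now a theorem of the tree (`trace_galoisRepTate_frobenius_holds`,
`FrobeniusTateModuleTraceProofs`).
[cite: SilvermanAEC2009, C.21 Remark 21.3, via Thm. V.2.3.1 and Prop. VII.4.1] -/
theorem trace_galoisRepTate_frobenius_of_hasGoodReductionAt_holds :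
    W.trace_galoisRepTate_frobenius_of_hasGoodReductionAt ℓ :=
  trace_galoisRepTate_frobenius_of_hasGoodReductionAt_of_finiteField (W := W) ℓ fun v ↦
    (W.reductionAt v).trace_galoisRepTate_frobenius_holds ℓ

/-- **Discharge of the named fact `det_galoisRepTate_frobenius_of_hasGoodReductionAt W ℓ`**
(Silverman, *AEC*, C.21 Remark 21.3, the norm: `Norm ρ(φ_v) = q_v`):
`det_galoisRepTate_frobenius_of_hasGoodReductionAt_of_exists_weilPairing`
(`HasseWeilGoodReductionFrobenius`: `det ρ_{E,ℓ} = χ_ℓ`, `χ_ℓ(Frob_v) = N v`) with the Weil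
pairings on `E[ℓ^{n+1}]` now proved (`exists_weilPairing_holds`, `WeilPairingProofs`, Prop. III.8.1).
[cite: SilvermanAEC2009, C.21 Remark 21.3, via Prop. III.8.1 and Prop. III.8.3] -/
theorem det_galoisRepTate_frobenius_of_hasGoodReductionAt_holds :
    W.det_galoisRepTate_frobenius_of_hasGoodReductionAt ℓ :=
  det_galoisRepTate_frobenius_of_hasGoodReductionAt_of_exists_weilPairing fun _ ↦
    W.exists_weilPairing_holds _

/-- **Discharge of the named fact `hasseWeilEulerFactor_of_hasGoodReduction W ℓ`**
(`HasseWeilGoodReduction`; Silverman, *AEC*, C.§16 with C.21 Remark 21.3 and Prop. VII.4.1: at a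
place `v ∤ ℓ` of good reduction the Euler factor `det(1 - Frob_v T | V_ℓ E)` is
`1 - a_v T + q_v T²`, Mathlib's local polynomial of the reduction of a minimal model):
`hasseWeilEulerFactor_of_hasGoodReduction_of_weilPairing_of_finiteField` with the Weil pairing
(Prop. III.8.1, `exists_weilPairing_holds`) and Thm. V.2.3.1 (`trace_galoisRepTate_frobenius_holds`)
now theorems of the tree.
[cite: SilvermanAEC2009, C.§16 and C.21 Remark 21.3, with Prop. VII.4.1 and Thm. V.2.3.1] -/
theorem hasseWeilEulerFactor_of_hasGoodReduction_holds :
    W.hasseWeilEulerFactor_of_hasGoodReduction ℓ :=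
  hasseWeilEulerFactor_of_hasGoodReduction_of_weilPairing_of_finiteField (W := W) ℓ
    (fun _ ↦ W.exists_weilPairing_holds _) fun v ↦
      (W.reductionAt v).trace_galoisRepTate_frobenius_holds ℓ

end WeierstrassCurve
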